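import Literature.MathematicalPhysics.QuantumFieldTheory.Balaban1983to89.B9Thm312WholeDirBCDs
import Literature.MathematicalPhysics.QuantumFieldTheory.Balaban1983to89.B9Thm313WholeHolderZ
import Literature.MathematicalPhysics.QuantumFieldTheory.Balaban1983to89.B9Thm313WholeDirZ
import Literature.MathematicalPhysics.QuantumFieldTheory.Balaban1983to89.B9RWSumsDefinitePinsPairM

/-!
# BalabanUVNodes ∕ N06 ([B9], `Dag.B9_main`) — THE StepDirB LAYER WITH THE (3.44)-TYPE SCHEMA `hdiv` WEAKENED TO THE ONE FIELD THE ENGINE READS (`h44Ds`: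
# `D*_U G₀ ∇*_{U,μ}` out of the bond input class), stated in the G₀ layer's regime where edition 36 DERIVES it — the `hdivDs` twin of `…StepDirLayerAtPinsBCZX.stepDirB_layer_of_lettersCZX` (p621378)
U-TWIN (seat `pub-ymgap-dag-n06-d` gen 15; dag-n06-l `ED47-REPLACEMENT-TABLE.md`, the option-(2) pin edition «U-dependent Hölder intermediates»): THIS FILE = the landed
`…StepDirLayerAtPinsBCZXDs.stepDirB_layer_of_lettersCZXDs` (p633826) VERBATIM with the Hölder intermediate `bH13` re-typed `∀ x, (bg x).Cfg → BlockNorm …`, its cost binder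
`hκ13 : ∀ x U, (bH13 x U).κ ≤ κ13`, and the displayed schemas `hLH3 ∕ hDM ∕ hXd ∕ hL3131H` reading `(bH13 x U)`; dag-n06-l's engine `stepDirB_of_letters3131LRCZ_ofDs` is per member and per
configuration, so the proof is unchanged (`hκx := (hκ13 x U).trans …`).  ★★ `stepDirB_layer_of_lettersCZXDsU`.  (The paragraphs below are p633826's, verbatim.)

Track A of `YM-PLAN.md` (cell `pub-ymgap`, HUMAN RULING D-0062), node **N06** = [Balaban1985BackgroundPropagators] Thms 3.1–3.15;
seat `pub-ymgap-dag-n06-d` (s2, «knit N06 at the ₁₁ record»), gen 12.  A HELPER for the stage-11 certificate editions ≥ 36.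

WHAT.  Editions 16–35 display rows 20–21's W-c schema `hdiv : … → Thm33G0DivR (𝔬12 x) (𝔡A x).Dsd 1 (H x) _ (bHXA x) (bHX x) BiD BdD δ12₀ δ12₃ U` — the record of BOTH
(3.44)-type members of [B9] Theorem 3.3 for `G₀ = G(U)` with the divergence on the left: `h44Ds μ ε` (`D*_U G₀ ∇*_{U,μ}` out of the bond input Hölder class, rate δ12₀) and
`h44DsDv ε` (`D*_U G₀ D_U` out of the scalar input Hölder class, rate δ12₃).  The engine this layer feeds, dag-n06-l's `B9Thm312WholeDirBC.stepDirB_of_letters3131LRCZ`, reads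
the record ONLY through `tDd_of_letters3131RC`, i.e. ONLY `h44Ds` (p. 421's placement rule: the perturbation Δ′_π stands to the LEFT of G₀∇*_{U,μ}; no member of the
(3.130)∕(3.138) expansions is D*_U applied after Δ′_πG₀D_U) — LOCATED-ED36-d (this seat, g12).  The second field is where a transport letter on `U` («small-gauge position») and
the rate inequality `δ12₃ ≤ δ12₀` would have to enter (dag-n06-l `h44DsDv_eps_pins`, dag-n06-w5 `thm33G0DivR_pins`); the first is dag-n06-w5's THEOREM `h44Ds_pins` of the
G₀ layer's derived `Thm33G0Dir` with neither.  So this file re-states the layer against this seat's engine twin `B9Thm312WholeDirBCDs.stepDirB_of_letters3131LRCZ_ofDs` (the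
engine VERBATIM with `hdiv` ↦ `hdivDs`): ★★ `stepDirB_layer_of_lettersCZXDs` = p621378's statement and proof VERBATIM except that (i) the binder `hdiv` is replaced by
`hdivDs : ∀ x, MD ≤ M_x → ∀ α₀ > 0, M_xα₀ ≤ a₀ → ∀ U, Reg335 → Reg336 → ∀ μ ε, 0 < ε → HasMaj (bHXA x ε) (cNormR 1 (H x) (𝔬12 x).blkW _ 0) ((𝔬12 x).Dvstar U ∘ₗ ((𝔬12 x).G0 U ∘ₗ
Dds x U μ)) (BiD ε·e^{−δ12₀d})` above its OWN threshold `MD` (new real input) in the `a₀`-regime — the shape `N06DivLegAtPinsPhys.hdivDs_of_pins` proves at the pins; (ii) the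
binders `bHW13` (the scalar input family of the unread field) and `BdD` (its constant) are gone; (iii) the output threshold is `M₀′ := max (max M₀ MD) (max M_L M_Lσ)` and the conclusion
gains the clause `MD ≤ M₀′` right after `M₀ ≤ M₀′` (so a consumer may route every pin-face threshold through `MD`).  Everything else — `q : PinPrims`; `𝔭A Dd Dds bHXA 𝔬12 bH13 κ13 hgeo`; the G₀ layer's outputs `hleft h33 h33R hX0` in (M₀, a₀); the displayed
schemas `hLH3 hDM hXd hvanishX hleX hL3131 hL3131H hR hstepL2` in (M12, a12) with `M12 ≤ M₀`, `a₀ ≤ a12`; the class relation `Rel` (R2-loc); signs, rates, the choices θ_D′, θ_H(β),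
θ_I(ε) and the conclusion — is IDENTICAL to p621378.
HONEST FRAMING.  Kernel bookkeeping (one displayed schema narrowed to the conjunct downstream uses; thresholds, one maximum, two functions by formula, one engine application per
member, four arithmetic dominations — all as in p621378); COUNT-NEUTRAL; nothing of [B9] asserted — the letter schemas remain displayed hypotheses about the genuine operators;
N06 NOT discharged.  One finite 𝕋⁴ programme at fixed `ε` — NOT continuum, NOT OS, NOT the mass gap ∕ Clay.  0 `def`, 0 `sorry`.
-/

noncomputable section

namespace Summit.QuantumFields.YangMills.BalabanUVNodes.N06StepDirLayerAtPinsBCZXDsU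

open Literature.MathematicalPhysics.QuantumFieldTheory.Balaban1983to89
open Literature.MathematicalPhysics.QuantumFieldTheory.Balaban1983to89.B9Thm34Ext (toB6)
open Literature.MathematicalPhysics.QuantumFieldTheory.Balaban1983to89.B11SectG (BlockNorm HasMaj RowSum)
open Literature.MathematicalPhysics.QuantumFieldTheory.Balaban1983to89.B9Thm312Whole (GeoOK cNorm)
open Literature.MathematicalPhysics.QuantumFieldTheory.Balaban1983to89.B9Thm312WholeClasses (cNormR)
open Literature.MathematicalPhysics.QuantumFieldTheory.Balaban1983to89.B9Thm312WholeLeft (LeftStep)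
open Literature.MathematicalPhysics.QuantumFieldTheory.Balaban1983to89.B9Thm312WholeDir (Thm33G0Dir)
open Literature.MathematicalPhysics.QuantumFieldTheory.Balaban1983to89.B9Thm312WholeDirB (StepDirB) open Literature.MathematicalPhysics.QuantumFieldTheory.Balaban1983to89.B9Thm312WholeDirBCDs (stepDirB_of_letters3131LRCZ_ofDs)
open Literature.MathematicalPhysics.QuantumFieldTheory.Balaban1983to89.B9Thm313WholeDir (Thm33G0DirR) open Literature.MathematicalPhysics.QuantumFieldTheory.Balaban1983to89.B9Thm313WholeDirZ (Letters313DMZ)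
open Literature.MathematicalPhysics.QuantumFieldTheory.Balaban1983to89.B9Thm313WholeHolderZ (Letters313HZ)
open Literature.MathematicalPhysics.QuantumFieldTheory.Balaban1983to89.B9Thm312WholeL2 (StepL2)
open Literature.MathematicalPhysics.QuantumFieldTheory.Balaban1983to89.B9RWSums343Holder (HolderProbes)
open Literature.MathematicalPhysics.QuantumFieldTheory.Balaban1983to89.B9RWSums343to347Whole (Facts347)
open Literature.MathematicalPhysics.QuantumFieldTheory.Balaban1983to89.B9RWSumsDefinitePins (PinPrims)
open Literature.MathematicalPhysics.QuantumFieldTheory.Balaban1983to89.B9RWSums347DefiniteFaces (exp261 lemma21Pack_geo9Y)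
open Literature.MathematicalPhysics.QuantumFieldTheory.Balaban1983to89.B9PinMembersKLevelV1 (MemberY geo9Y)
open Literature.MathematicalPhysics.QuantumFieldTheory.Balaban1983to89.B9GeoLemma21KLevelV1 (geo9Y_len_pos rowSum261_geo9Y)
open Literature.MathematicalPhysics.QuantumFieldTheory.Balaban1983to89.B9Thm312WholeStepFrom3131 (Letters3131)
open Literature.MathematicalPhysics.QuantumFieldTheory.Balaban1983to89.B9Thm312WholeLeftStepFrom3131 (Letters3131H)
open Literature.MathematicalPhysics.QuantumFieldTheory.Balaban1983to89.B9Thm312WholeStepDirFrom3131 (Thm33G0DirX)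
open Literature.MathematicalPhysics.QuantumFieldTheory.Balaban1983to89.B9Thm312WholeRightStepFrom3131 (Letters3131R)

variable {d ℓ : ℕ} {hd : 1 ≤ d + 1} {hL : Odd (ℓ + 1) ∧ 1 < ℓ + 1} {b₀ b₁ : ℝ} {Mstar : ℕ}
variable [∀ x : MemberY d ℓ hd hL b₀ b₁ Mstar, Fintype (geo9Y x).Site]
variable {c35 : ℝ} {bg : MemberY d ℓ hd hL b₀ b₁ Mstar → B9.Backgrounds}

/-- the pointwise domination pattern with the cutting constant: `κ ≤ κM`, `0 ≤ b` and `2((a + κM·b)·t·c) ≤ θ` give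
`2((a + κ·b)·(t·m)·c) ≤ θ·m`. [folklore] -/
private theorem dom_two {a κ κM b t m c θ : ℝ} (hκ : κ ≤ κM) (hb0 : 0 ≤ b)
    (ht : 0 ≤ t) (hm : 0 ≤ m) (hc : 0 ≤ c) (hθ : 2 * ((a + κM * b) * t * c) ≤ θ) : 2 * ((a + κ * b) * (t * m) * c) ≤ θ * m := by
  have h1 : κ * b ≤ κM * b := mul_le_mul_of_nonneg_right hκ hb0
  have h2 : a + κ * b ≤ a + κM * b := by linarith only [h1]
  have h3 : (a + κ * b) * t * c ≤ (a + κM * b) * t * c := mul_le_mul_of_nonneg_right (mul_le_mul_of_nonneg_right h2 ht) hc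
  calc 2 * ((a + κ * b) * (t * m) * c) = 2 * ((a + κ * b) * t * c) * m := by ring
    _ ≤ 2 * ((a + κM * b) * t * c) * m := mul_le_mul_of_nonneg_right (by linarith only [h3]) hm
    _ ≤ θ * m := mul_le_mul_of_nonneg_right hθ hm

/-- the pointwise domination with the lattice factor: `2(A·t·c·L) ≤ θ` gives `2(A·(t·m)·c·L) ≤ θ·m`. [folklore] -/
private theorem dom_L {A t m c L θ : ℝ} (hm : 0 ≤ m) (hθ : 2 * (A * t * c * L) ≤ θ) : 2 * (A * (t * m) * c * L) ≤ θ * m := by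
  calc 2 * (A * (t * m) * c * L) = 2 * (A * t * c * L) * m := by ring
    _ ≤ θ * m := mul_le_mul_of_nonneg_right hθ hm

/-- the pointwise domination without extra factors: `2(A·t·c) ≤ θ` gives `2(A·(t·m)·c) ≤ θ·m`. [folklore] -/
private theorem dom_one {A t m c θ : ℝ} (hm : 0 ≤ m) (hθ : 2 * (A * t * c) ≤ θ) : 2 * (A * (t * m) * c) ≤ θ * m := by
  calc 2 * (A * (t * m) * c) = 2 * (A * t * c) * m := by ring
    _ ≤ θ * m := mul_le_mul_of_nonneg_right hθ hm

set_option maxHeartbeats 400000 in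
/-- ★★ **THE `U`-TWIN (Hölder intermediate `bH13 x U`) OF THE `hdivDs` LAYER** `stepDirB_layer_of_lettersCZXDs` (p633826; module docstring): the binder `hdiv : … Thm33G0DivR … (bHXA x) (bHW13 x) BiD BdD δ12₀ δ12₃ U`
(regime (M12, a12)) is replaced by the ONE field the engine reads, `hdivDs` (`D*_U G₀ ∇*_{U,μ}` out of `bHXA x ε` into `𝔠_W⁽⁰⁾`, majorant `BiD ε·e^{−δ12₀d}`), stated above its own
threshold `MD` in the G₀ layer's `a₀`-regime (where edition 36 DERIVES it, `N06DivLegAtPinsPhys.hdivDs_of_pins`); the binders `bHW13 BdD` disappear; the output threshold is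
`M₀′ := max (max M₀ MD) (max M_L M_Lσ)` (the conclusion gains `MD ≤ M₀′` right after `M₀ ≤ M₀′`); the engine is this seat's `B9Thm312WholeDirBCDs.stepDirB_of_letters3131LRCZ_ofDs`; statement, choices
(θ_D′, θ_H(β), θ_I(ε)) and conclusion `∃ θD′ θH θI M₀′, … LeftStep … ∧ (StepDirB … ∧ StepL2 …)` otherwise IDENTICAL.
[cite: Balaban1985BackgroundPropagators, Thm 3.12 p.423 + (3.130)–(3.131) pp.421–422 + (3.137)–(3.138) p.423 + (3.42)–(3.45) pp.397–398 + p.398 + p.421; Balaban1984PropagatorsII, Lemma 2.1 (2.61) p.234 + (2.26) p.228] -/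
theorem stepDirB_layer_of_lettersCZXDsU {X Y PX PY Z W P : MemberY d ℓ hd hL b₀ b₁ Mstar → Type}
    [∀ x, Fintype (X x)] [∀ x, Fintype (Y x)] [∀ x, Fintype (PX x)] [∀ x, Fintype (PY x)] [∀ x, Fintype (Z x)] [∀ x, Fintype (W x)]
    [∀ x, Fintype (P x)]
    (q : PinPrims) (hq : q.OK) (H : MemberY d ℓ hd hL b₀ b₁ Mstar → Prop)
    (𝔭A : ∀ x : MemberY d ℓ hd hL b₀ b₁ Mstar, HolderProbes (geo9Y x) (bg x) (X x) (Y x) (PX x) (PY x))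
    (Dd Dds : ∀ x : MemberY d ℓ hd hL b₀ b₁ Mstar, (bg x).Cfg → P x → Module.End ℝ (X x → ℝ))
    (bHXA : ∀ x : MemberY d ℓ hd hL b₀ b₁ Mstar, ℝ → BlockNorm (toB6 (geo9Y x) 1 (H x)) (X x → ℝ))
    (𝔬12 : ∀ x : MemberY d ℓ hd hL b₀ b₁ Mstar, B9Thm312Whole.Ops (geo9Y x) (bg x) (X x) (Y x) (Z x) (W x))
    (bH13 : ∀ x : MemberY d ℓ hd hL b₀ b₁ Mstar, (bg x).Cfg → BlockNorm (toB6 (geo9Y x) 1 (H x)) (W x → ℝ)) (κ13 : ℝ) (hκ13 : ∀ x U, (bH13 x U).κ ≤ κ13)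
    (hgeo : ∀ x : MemberY d ℓ hd hL b₀ b₁ Mstar, GeoOK (geo9Y x))
    -- numerics: the core helper's constants ∕ thresholds and the certificate's rates (NO β-∕ε-uniform bounds)
    (B12₀ δ12₀ δK12 B12₃ δ12₃ t12 δT12 ρS σS θD θ2₁₂ M₀ a₀ M12 a12 MD : ℝ) (Bh12 Bi12 Bq12 BhD13 Bx13 Bx0 BdX BiD : ℝ → ℝ)
    (Bi2₁₂ : ℝ → ℝ → ℝ)
    (hB12₀ : 0 ≤ B12₀) (hB12₃ : 0 ≤ B12₃) (ht12 : 0 ≤ t12) (hθD : 0 ≤ θD) (hM₀ : 0 < M₀) (hMM : M12 ≤ M₀) (haa : a₀ ≤ a12)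
    (hBh12 : ∀ β, 0 ≤ β → β < 1 → 0 ≤ Bh12 β)
    (hBhD13 : ∀ β, 0 ≤ β → β < 1 → 0 ≤ BhD13 β) (hBx13 : ∀ β, 0 ≤ β → β < 1 → 0 ≤ Bx13 β) (hBx0 : ∀ β, 0 ≤ β → β < 1 → 0 ≤ Bx0 β)
    (hBdX : ∀ β, 0 ≤ β → β < 1 → 0 ≤ BdX β) (hBiD : ∀ ε, 0 < ε → 0 ≤ BiD ε)
    (hσS : 0 < σS) (hρST : ρS ≤ δT12) (hρS₀ : ρS + σS ≤ δ12₀) (hρS₃ : ρS + σS ≤ δ12₃) (hδK0 : 0 ≤ δK12)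
    (hδKS : δK12 + q.αF * ((1 - 2 * q.α) * q.δ₀) ≤ ρS)
    -- the core helper's output families in its regime (M₀, a₀)
    (hleft : ∀ x : MemberY d ℓ hd hL b₀ b₁ Mstar, M₀ ≤ (geo9Y x).M → ∀ α₀ : ℝ, 0 < α₀ → (geo9Y x).M * α₀ ≤ a₀ →
      ∀ U : (bg x).Cfg, (bg x).Reg335 c35 α₀ U → (bg x).Reg336 c35 α₀ U →
        LeftStep (𝔬12 x) 1 (H x) (fun y => (geo9Y_len_pos x y).le) B12₀ δ12₀ (θD * ((geo9Y x).M * α₀)) δK12 U)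
    (h33 : ∀ x : MemberY d ℓ hd hL b₀ b₁ Mstar, M₀ ≤ (geo9Y x).M → ∀ α₀ : ℝ, 0 < α₀ → (geo9Y x).M * α₀ ≤ a₀ →
      ∀ U : (bg x).Cfg, (bg x).Reg335 c35 α₀ U → (bg x).Reg336 c35 α₀ U →
        Thm33G0Dir (𝔬12 x) (𝔭A x) (Dd x) (Dds x) 1 (H x) (bHXA x) B12₀ Bh12 Bi12 Bi2₁₂ δ12₀ U)
    (h33R : ∀ x : MemberY d ℓ hd hL b₀ b₁ Mstar, M₀ ≤ (geo9Y x).M → ∀ α₀ : ℝ, 0 < α₀ → (geo9Y x).M * α₀ ≤ a₀ →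
      ∀ U : (bg x).Cfg, (bg x).Reg335 c35 α₀ U → (bg x).Reg336 c35 α₀ U → Thm33G0DirR (𝔬12 x) (Dds x) 1 (H x) B12₀ δ12₀ U)
    -- the displayed schemas of rows 20–21 in Theorem 3.12's regime (M12, a12)
    (wZ : ∀ x : MemberY d ℓ hd hL b₀ b₁ Mstar, (geo9Y x).Site → ℝ) (hwZ : ∀ (x : MemberY d ℓ hd hL b₀ b₁ Mstar) (y : (geo9Y x).Site), 0 < wZ x y)
    (hLH3 : ∀ x : MemberY d ℓ hd hL b₀ b₁ Mstar, M12 ≤ (geo9Y x).M → ∀ α₀ : ℝ, 0 < α₀ → (geo9Y x).M * α₀ ≤ a12 →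
      ∀ U : (bg x).Cfg, (bg x).Reg335 c35 α₀ U → (bg x).Reg336 c35 α₀ U →
        Letters313HZ (𝔬12 x) (𝔭A x) 1 (H x) (hgeo x) (wZ x) (hwZ x) (bH13 x U) BhD13 Bx13 δ12₃ U)
    (hDM : ∀ x : MemberY d ℓ hd hL b₀ b₁ Mstar, M12 ≤ (geo9Y x).M → ∀ α₀ : ℝ, 0 < α₀ → (geo9Y x).M * α₀ ≤ a12 →
      ∀ U : (bg x).Cfg, (bg x).Reg335 c35 α₀ U → (bg x).Reg336 c35 α₀ U →
        Letters313DMZ (𝔬12 x) (𝔭A x) (Dd x) 1 (H x) (hgeo x) (wZ x) (hwZ x) B12₃ Bq12 δ12₃ (bH13 x U) U)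
    -- the `pX0` face of edition ≤ 30's `hX : Thm33G0DirX …` in the G₀ LAYER's regime (M₀, a₀) (derivable there from `Thm33G0.e0 ∕ Thm33G0Dir.e1d` at the cut probe carrier)
    (hX0 : ∀ x : MemberY d ℓ hd hL b₀ b₁ Mstar, M₀ ≤ (geo9Y x).M → ∀ α₀ : ℝ, 0 < α₀ → (geo9Y x).M * α₀ ≤ a₀ →
      ∀ U : (bg x).Cfg, (bg x).Reg335 c35 α₀ U → (bg x).Reg336 c35 α₀ U → ∀ β : ℝ, 0 ≤ β → β < 1 →
        HasMaj (cNormR 1 (H x) (𝔬12 x).blk (fun y => (geo9Y_len_pos x y).le) 0) (cNormR 1 (H x) (𝔭A x).blkPX (fun y => (geo9Y_len_pos x y).le) (β - 2))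
          ((𝔭A x).ΦX U β ∘ₗ (𝔬12 x).G0 U) (fun a b => Bx0 β * Real.exp (-(δ12₀ * (geo9Y x).dist a b))))
    -- the `pXdDH` face (displayed) in Theorem 3.12's regime (M12, a12)
    (hXd : ∀ x : MemberY d ℓ hd hL b₀ b₁ Mstar, M12 ≤ (geo9Y x).M → ∀ α₀ : ℝ, 0 < α₀ → (geo9Y x).M * α₀ ≤ a12 →
      ∀ U : (bg x).Cfg, (bg x).Reg335 c35 α₀ U → (bg x).Reg336 c35 α₀ U → ∀ (ν : P x) (β : ℝ), 0 ≤ β → β < 1 →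
        HasMaj (bH13 x U) (cNormR 1 (H x) (𝔭A x).blkPX (fun y => (geo9Y_len_pos x y).le) (β - 1))
          (((𝔭A x).ΦX U β ∘ₗ Dd x U ν ∘ₗ (𝔬12 x).G0 U) ∘ₗ (𝔬12 x).Dv U) (fun a b => BdX β * Real.exp (-(δ12₃ * (geo9Y x).dist a b))))
    -- the (3.44)-type member D*_U G₀ ∇*_{U,μ} out of the bond input class (`Thm33G0DivR.h44Ds` ALONE — the engine reads no other field), above its own threshold MD
    (hdivDs : ∀ x : MemberY d ℓ hd hL b₀ b₁ Mstar, MD ≤ (geo9Y x).M → ∀ α₀ : ℝ, 0 < α₀ → (geo9Y x).M * α₀ ≤ a₀ →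
      ∀ U : (bg x).Cfg, (bg x).Reg335 c35 α₀ U → (bg x).Reg336 c35 α₀ U → ∀ (μ : P x) (ε : ℝ), 0 < ε →
        HasMaj (bHXA x ε) (cNormR 1 (H x) (𝔬12 x).blkW (fun y => (geo9Y_len_pos x y).le) 0)
          ((𝔬12 x).Dvstar U ∘ₗ ((𝔬12 x).G0 U ∘ₗ Dds x U μ)) (fun a b => BiD ε * Real.exp (-(δ12₀ * (geo9Y x).dist a b))))
    -- R2-loc (dag-n06-l g15 `Letters313IMBC` ∕ `stepDirB_of_letters3131LRCZ`): the input norm's localisation is read against the fibre blocks through a CLASS relation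
    (Rel : ∀ x : MemberY d ℓ hd hL b₀ b₁ Mstar, (geo9Y x).Site → (geo9Y x).Site → Prop) [∀ x, DecidableRel (Rel x)] (mR : ℝ) (hmR : 0 ≤ mR)
    (hmult : ∀ (x : MemberY d ℓ hd hL b₀ b₁ Mstar) (y' : (geo9Y x).Site), ((Finset.univ.filter (fun y'' => Rel x y'' y')).card : ℝ) ≤ mR)
    (hRel : ∀ (x : MemberY d ℓ hd hL b₀ b₁ Mstar) (a b b' : (geo9Y x).Site), Rel x b' b → (geo9Y x).dist a b' = (geo9Y x).dist a b)
    (hvanishX : ∀ x : MemberY d ℓ hd hL b₀ b₁ Mstar, M12 ≤ (geo9Y x).M → ∀ α₀ : ℝ, 0 < α₀ → (geo9Y x).M * α₀ ≤ a12 →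
      ∀ U : (bg x).Cfg, (bg x).Reg335 c35 α₀ U → (bg x).Reg336 c35 α₀ U →
        ∀ ε : ℝ, 0 < ε → ∀ (y' : (geo9Y x).Site) (μ : X x → ℝ), (bHXA x ε).IsLoc y' μ → ∀ y'' : (geo9Y x).Site, ¬ Rel x y'' y' →
          (BlockNorm.ofBlocks (toB6 (geo9Y x) 1 (H x)) (𝔬12 x).blk).cut y'' μ = 0)
    (hleX : ∀ x : MemberY d ℓ hd hL b₀ b₁ Mstar, M12 ≤ (geo9Y x).M → ∀ α₀ : ℝ, 0 < α₀ → (geo9Y x).M * α₀ ≤ a12 →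
      ∀ U : (bg x).Cfg, (bg x).Reg335 c35 α₀ U → (bg x).Reg336 c35 α₀ U →
        ∀ ε : ℝ, 0 < ε → ∀ (y' : (geo9Y x).Site) (μ : X x → ℝ), (bHXA x ε).IsLoc y' μ → ∀ y'' : (geo9Y x).Site, Rel x y'' y' →
          (BlockNorm.ofBlocks (toB6 (geo9Y x) 1 (H x)) (𝔬12 x).blk).loc y'' ((BlockNorm.ofBlocks (toB6 (geo9Y x) 1 (H x)) (𝔬12 x).blk).cut y'' μ) ≤ (bHXA x ε).loc y' μ)
    (Ta Ta₂ Ta' Ta₂' : ∀ x : MemberY d ℓ hd hL b₀ b₁ Mstar, (bg x).Cfg → Module.End ℝ (X x → ℝ))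
    (Tb Tb₂ : ∀ x : MemberY d ℓ hd hL b₀ b₁ Mstar, (bg x).Cfg → (X x → ℝ) →ₗ[ℝ] (W x → ℝ))
    (Tb' Tb₂' : ∀ x : MemberY d ℓ hd hL b₀ b₁ Mstar, (bg x).Cfg → (W x → ℝ) →ₗ[ℝ] (X x → ℝ))
    (hL3131 : ∀ x : MemberY d ℓ hd hL b₀ b₁ Mstar, M12 ≤ (geo9Y x).M → ∀ α₀ : ℝ, 0 < α₀ → (geo9Y x).M * α₀ ≤ a12 →
      ∀ U : (bg x).Cfg, (bg x).Reg335 c35 α₀ U → (bg x).Reg336 c35 α₀ U →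
        Letters3131 (𝔬12 x) (Ta x) (Ta₂ x) (Tb x) (Tb₂ x) 1 (H x) (fun y => (geo9Y_len_pos x y).le) (t12 * ((geo9Y x).M * α₀)) δT12 U)
    (hL3131H : ∀ x : MemberY d ℓ hd hL b₀ b₁ Mstar, M12 ≤ (geo9Y x).M → ∀ α₀ : ℝ, 0 < α₀ → (geo9Y x).M * α₀ ≤ a12 →
      ∀ U : (bg x).Cfg, (bg x).Reg335 c35 α₀ U → (bg x).Reg336 c35 α₀ U →
        Letters3131H (𝔬12 x) (Tb x) (Tb₂ x) 1 (H x) (fun y => (geo9Y_len_pos x y).le) (bH13 x U) (t12 * ((geo9Y x).M * α₀)) δT12 U)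
    (hR : ∀ x : MemberY d ℓ hd hL b₀ b₁ Mstar, M12 ≤ (geo9Y x).M → ∀ α₀ : ℝ, 0 < α₀ → (geo9Y x).M * α₀ ≤ a12 →
      ∀ U : (bg x).Cfg, (bg x).Reg335 c35 α₀ U → (bg x).Reg336 c35 α₀ U →
        Letters3131R (𝔬12 x) (Ta' x) (Ta₂' x) (Tb' x) (Tb₂' x) 1 (H x) (fun y => (geo9Y_len_pos x y).le) (t12 * ((geo9Y x).M * α₀)) δT12 U)
    (hstepL2 : ∀ x : MemberY d ℓ hd hL b₀ b₁ Mstar, M12 ≤ (geo9Y x).M → ∀ α₀ : ℝ, 0 < α₀ → (geo9Y x).M * α₀ ≤ a12 →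
      ∀ U : (bg x).Cfg, (bg x).Reg335 c35 α₀ U → (bg x).Reg336 c35 α₀ U →
        StepL2 (𝔬12 x) 1 (H x) (θ2₁₂ * ((geo9Y x).M * α₀)) δK12 U) :
    ∃ (θD' : ℝ) (θH θI : ℝ → ℝ) (M₀' : ℝ), 0 ≤ θD' ∧ (∀ β, 0 ≤ β → β < 1 → 0 ≤ θH β) ∧ (∀ ε, 0 < ε → 0 ≤ θI ε) ∧ M₀ ≤ M₀' ∧ MD ≤ M₀' ∧
      (∀ x : MemberY d ℓ hd hL b₀ b₁ Mstar, M₀' ≤ (geo9Y x).M → ∀ α₀ : ℝ, 0 < α₀ → (geo9Y x).M * α₀ ≤ a₀ →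
        ∀ U : (bg x).Cfg, (bg x).Reg335 c35 α₀ U → (bg x).Reg336 c35 α₀ U →
          LeftStep (𝔬12 x) 1 (H x) (fun y => (geo9Y_len_pos x y).le) B12₀ δ12₀ (θD' * ((geo9Y x).M * α₀)) δK12 U) ∧
      (∀ x : MemberY d ℓ hd hL b₀ b₁ Mstar, M₀' ≤ (geo9Y x).M → ∀ α₀ : ℝ, 0 < α₀ → (geo9Y x).M * α₀ ≤ a₀ →
        ∀ U : (bg x).Cfg, (bg x).Reg335 c35 α₀ U → (bg x).Reg336 c35 α₀ U →
          StepDirB (𝔬12 x) (𝔭A x) (Dd x) (Dds x) 1 (H x) (bHXA x) (fun y => (geo9Y_len_pos x y).le) (θD' * ((geo9Y x).M * α₀))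
            (fun β => θH β * ((geo9Y x).M * α₀)) (fun ε => θI ε * ((geo9Y x).M * α₀)) δK12 U ∧
          StepL2 (𝔬12 x) 1 (H x) (θ2₁₂ * ((geo9Y x).M * α₀)) δK12 U) := by
  -- p. 398's member facts at ((1 − 2α)δ₀, α_F) and [4] (2.61) at the rate σS, above ONE threshold each (n06-k ∕ n06-i)
  obtain ⟨ML, -, hfacts, -⟩ :=
    lemma21Pack_geo9Y (d := d) (ℓ := ℓ) (hd := hd) (hL := hL) (b₀ := b₀) (b₁ := b₁) (Mstar := Mstar) H hq.α_pos hq.α_lt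
      hq.δ₀_pos hq.αF_pos (by linarith only [hq.αF_lt])
  obtain ⟨MLσ, cσ, hrow0⟩ := rowSum261_geo9Y (d := d) (ℓ := ℓ) (hd := hd) (hL := hL) (b₀ := b₀) (b₁ := b₁) (Mstar := Mstar) σS hσS
  set c : ℝ := max cσ 0 with hc'
  have hc0 : 0 ≤ c := le_max_right _ _
  have hrow : ∀ x : MemberY d ℓ hd hL b₀ b₁ Mstar, MLσ ≤ (geo9Y x).M → RowSum (toB6 (geo9Y x) 1 (H x)) σS c :=
    fun x hM y => (hrow0 x hM y).trans (le_max_left _ _)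
  set L₀ : ℝ := ((ℓ + 1 : ℕ) : ℝ) with hL₀
  have hL₀0 : 0 ≤ L₀ := by rw [hL₀]; positivity
  set κM : ℝ := max κ13 0 with hκM
  have hκM0 : 0 ≤ κM := le_max_right _ _
  -- the step constants BY CHOICE: θ_D′ a number, θ_H and θ_I FUNCTIONS of the exponent (print: B₀(β), B′₀(ε), pp. 397–398)
  set θD' : ℝ := max θD (2 * ((B12₀ + κM * B12₃) * t12 * c)) with hθD'
  set θH : ℝ → ℝ := fun β => 2 * ((Bh12 β + κM * BhD13 β) * t12 * c) + 2 * ((Bh12 β + κM * BdX β) * t12 * c) +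
    2 * ((Bx0 β + Bx13 β) * t12 * c * L₀) with hθH
  set θI : ℝ → ℝ := fun ε => 2 * ((mR * B12₀ * L₀ + BiD ε) * t12 * c) with hθI
  set M₀' : ℝ := max (max M₀ MD) (max ML MLσ) with hM₀'
  have hθD'0 : 0 ≤ θD' := hθD.trans (le_max_left _ _)
  have hH1 : ∀ β, 0 ≤ β → β < 1 → 0 ≤ 2 * ((Bh12 β + κM * BhD13 β) * t12 * c) := fun β h0 h1 =>
    mul_nonneg (by norm_num) (mul_nonneg (mul_nonneg (add_nonneg (hBh12 β h0 h1) (mul_nonneg hκM0 (hBhD13 β h0 h1))) ht12) hc0)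
  have hH2 : ∀ β, 0 ≤ β → β < 1 → 0 ≤ 2 * ((Bh12 β + κM * BdX β) * t12 * c) := fun β h0 h1 =>
    mul_nonneg (by norm_num) (mul_nonneg (mul_nonneg (add_nonneg (hBh12 β h0 h1) (mul_nonneg hκM0 (hBdX β h0 h1))) ht12) hc0)
  have hH3 : ∀ β, 0 ≤ β → β < 1 → 0 ≤ 2 * ((Bx0 β + Bx13 β) * t12 * c * L₀) := fun β h0 h1 =>
    mul_nonneg (by norm_num) (mul_nonneg (mul_nonneg (mul_nonneg (add_nonneg (hBx0 β h0 h1) (hBx13 β h0 h1)) ht12) hc0) hL₀0)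
  have hθH0 : ∀ β, 0 ≤ β → β < 1 → 0 ≤ θH β := fun β h0 h1 => by
    simp only [hθH]; linarith only [hH1 β h0 h1, hH2 β h0 h1, hH3 β h0 h1]
  have hθI0 : ∀ ε, 0 < ε → 0 ≤ θI ε := fun ε hε => by
    simp only [hθI]
    exact mul_nonneg (by norm_num) (mul_nonneg (mul_nonneg (add_nonneg (mul_nonneg (mul_nonneg hmR hB12₀) hL₀0) (hBiD ε hε)) ht12) hc0)
  have hαFδ : 0 ≤ q.αF * ((1 - 2 * q.α) * q.δ₀) :=
    mul_nonneg hq.αF_pos.le (mul_nonneg (by linarith only [hq.α_lt]) hq.δ₀_pos.le)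
  refine ⟨θD', θH, θI, M₀', hθD'0, hθH0, hθI0, (le_max_left _ _).trans (le_max_left _ _), (le_max_right _ _).trans (le_max_left _ _),
    fun x hM α₀ hα ha U hU hU' => ?_,
    fun x hM α₀ hα ha U hU hU' => ?_⟩
  all_goals
    have hM0x : M₀ ≤ (geo9Y x).M := ((le_max_left _ _).trans (le_max_left _ _)).trans hM
    have hMDx : MD ≤ (geo9Y x).M := ((le_max_right _ _).trans (le_max_left _ _)).trans hM
    have hM12x : M12 ≤ (geo9Y x).M := hMM.trans hM0x
    have hMLx : ML ≤ (geo9Y x).M := ((le_max_left _ _).trans (le_max_right _ _)).trans hM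
    have hMLσx : MLσ ≤ (geo9Y x).M := ((le_max_right _ _).trans (le_max_right _ _)).trans hM
    have ha12x : (geo9Y x).M * α₀ ≤ a12 := ha.trans haa
    have hMpos : 0 < (geo9Y x).M := lt_of_lt_of_le hM₀ hM0x
    have hMα : 0 ≤ (geo9Y x).M * α₀ := mul_nonneg hMpos.le hα.le
    have hw : ∀ a b : (geo9Y x).Site, θD * ((geo9Y x).M * α₀) * Real.exp (-(δK12 * (toB6 (geo9Y x) 1 (H x)).dist a b)) ≤
        θD' * ((geo9Y x).M * α₀) * Real.exp (-(δK12 * (toB6 (geo9Y x) 1 (H x)).dist a b)) := fun a b =>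
      mul_le_mul_of_nonneg_right (mul_le_mul_of_nonneg_right (le_max_left _ _) hMα) (Real.exp_nonneg _)
  · obtain ⟨he1, hsd, hsd1⟩ := hleft x hM0x α₀ hα ha U hU hU'
    exact ⟨he1, hsd.mono hw, hsd1.mono hw⟩
  · have hκx : (bH13 x U).κ ≤ κM := (hκ13 x U).trans (le_max_left _ _)
    have hS := stepDirB_of_letters3131LRCZ_ofDs (R₀ := 1) (H₀ := H x) (hgeo x) (hfacts x hMLx) (hrow x hMLσx) hc0 hB12₀ hB12₃
      (mul_nonneg ht12 hMα) hBh12 hBhD13 hBx13 hBx0 hBdX hBiD (Rel x) hmR (hmult x) (hRel x) hρST hρS₀ hρS₃ hαFδ hδK0 hδKS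
      (θD := θD' * ((geo9Y x).M * α₀)) (θH := fun β => θH β * ((geo9Y x).M * α₀)) (θI := fun ε => θI ε * ((geo9Y x).M * α₀))
      (dom_two hκx hB12₃ ht12 hMα hc0 (le_max_right _ _))
      (fun β hβ0 hβ1 => dom_two hκx (hBhD13 β hβ0 hβ1) ht12 hMα hc0 (by
        simp only [hθH]; linarith only [hH2 β hβ0 hβ1, hH3 β hβ0 hβ1]))
      (fun β hβ0 hβ1 => dom_two hκx (hBdX β hβ0 hβ1) ht12 hMα hc0 (by
        simp only [hθH]; linarith only [hH1 β hβ0 hβ1, hH3 β hβ0 hβ1]))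
      (fun β hβ0 hβ1 => dom_L hMα (by simp only [hθH]; linarith only [hH1 β hβ0 hβ1, hH2 β hβ0 hβ1]))
      (fun ε hε => dom_one hMα (by simp only [hθI]; exact le_rfl))
      (h33 x hM0x α₀ hα ha U hU hU') (h33R x hM0x α₀ hα ha U hU hU') (hLH3 x hM12x α₀ hα ha12x U hU hU')
      (hDM x hM12x α₀ hα ha12x U hU hU')
      (⟨hX0 x hM0x α₀ hα ha U hU hU', hXd x hM12x α₀ hα ha12x U hU hU'⟩ : Thm33G0DirX (𝔬12 x) (𝔭A x) (Dd x) 1 (H x) (fun y => (geo9Y_len_pos x y).le) (bH13 x U) Bx0 BdX δ12₀ δ12₃ U)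
      (hdivDs x hMDx α₀ hα ha U hU hU')
      (hvanishX x hM12x α₀ hα ha12x U hU hU') (hleX x hM12x α₀ hα ha12x U hU hU') (hL3131 x hM12x α₀ hα ha12x U hU hU')
      (hL3131H x hM12x α₀ hα ha12x U hU hU') (hR x hM12x α₀ hα ha12x U hU hU')
    exact ⟨hS, hstepL2 x hM12x α₀ hα ha12x U hU hU'⟩

end Summit.QuantumFields.YangMills.BalabanUVNodes.N06StepDirLayerAtPinsBCZXDsU

end
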